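import Summits.HubbardSuperconductivity.HubbardSuperconductivity.Theorems.AnisotropyChordStiffnessDefs
import Summits.HubbardSuperconductivity.HubbardSuperconductivity.Theorems.AnisotropyChordStiffnessFilteredLocality

/-!
# Route `AnisotropyChord` / H0 rotor rung: `FilteredLocalityIdentity` HOLDS (stub (S1) = L1 of THEOREM TWIST-IR)

The typed first lemma `Stiffness.FilteredLocalityIdentity` (theory seat cycle 8, memo ROTOR-THEORY-8 §107/§109,
`AnisotropyChordStiffnessDefs`) is discharged by `filteredLocality_identity`
(`AnisotropyChordStiffnessFilteredLocality`).
-/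

set_option linter.dupNamespace false

noncomputable section

namespace Summit.HubbardSuperconductivity.HubbardSuperconductivity.Theorems.AnisotropyChord.Stiffness

/-- **`FilteredLocalityIdentity` HOLDS** — stub (S1) / lemma L1 of THEOREM TWIST-IR is a tree theorem
(theory seat memo ROTOR-THEORY-8 §109). [folklore] -/
theorem filteredLocalityIdentity_holds : FilteredLocalityIdentity :=
  fun _ _ _ H hH A B ψ E₀ hψ hsec w hw g hg hg0 =>
    filteredLocality_identity H hH A B ψ E₀ hψ hsec w hw g hg hg0

end Summit.HubbardSuperconductivity.HubbardSuperconductivity.Theorems.AnisotropyChord.Stiffness
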